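import Mathlib
import Summits.NavierStokesRegularity.NavierStokesRegularity.Theorems.SubOnsagerCeilingKPStarvedNetworkStarvation
import HarnessLib

/-!
# STARVED NETWORKS, GENERAL FORM — the live-block balance and the starved fluxes (part 2 of 3)
# (helper file for the crux `SubOnsagerCeiling.ForwardTailCeilingKP`, stmt-NavierStokesRegularity-27057, `--supports`)

Class as in `Theorems/SubOnsagerCeilingKPStarvedNetworkStarvation.lean` (pockets `Q` forward-dead and pump-dead, live modes `∉ Q` with any
diagonal forward network among themselves, leaks `w_{ad}` and pumps `P a d` into the pockets, no other in-shell triads).  Along every honest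
non-negative `ν`-viscous solution from a one-shell datum on shell `0`, with the fluxes
`LIN_n = Λ_{n-1} Σ_{e∉Q} Σ_a w_{ae} x²_{a,n-1} x_{e,n}` (live in-flux), `OUT_n = Λₙ Σ_{i,j} w_{ij} x²_{i,n} x_{j,n+1}` (gate flux),
`LOUT_n = Λₙ Σ_i Σ_{j∉Q} w_{ij} x²_{i,n} x_{j,n+1}` (its live part; `= LIN_{n+1}`), `PUMP_n = Λₙ Σ_i x²_{i,n} Σ_d P i d·x_{d,n}`:

* `starved_liveBlock_identity` — `Σ_{e∉Q} x_{e,n}·quadTerm_e(n) = LIN_n − OUT_n − PUMP_n` (algebra);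
* `starved_live_balance` — `∫₀ᵗ OUT_n + ∫₀ᵗ PUMP_n ≤ ∫₀ᵗ LIN_n` for `n ≥ 1` (live energy and dissipation are `≥ 0`);
* `starved_exit_dominates` — `(1+r)·LOUT_n ≤ OUT_n + PUMP_n` pointwise for `n ≥ 1` under GRAM DOMINATION (`starved_domination`);
* `starved_flux_step` — `(1+r)·∫₀ᵗ LOUT_n ≤ ∫₀ᵗ LIN_n` (`n ≥ 1`); `starved_liveOut_eq_liveIn_succ` — `LOUT_n = LIN_{n+1}`;
* `starved_liveFlux_le` — `∫₀ᵗ LOUT_m ≤ E₀·q^m`, `q = (1+r)⁻¹`, every `m : ℕ`.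

The sequel `Theorems/SubOnsagerCeilingKPStarvedNetworkBarrier.lean`: `∫₀ᵗ OUT_m ≤ E₀·(1+r)·q^m` and `ShellBarrierAt R ε₀ α` when `r > ε₀`.
HONEST FRAMING: statements about Tao-type MODEL lattice ODEs (route SubOnsagerCeiling, rung TL-M2Break); energy bookkeeping for one
architecture class; no stub, crux or summit is proved and nothing here bears on Navier–Stokes regularity.
[cite: Tao2016AveragedNS, §4 (4.2)–(4.3), (4.8)–(4.9), (4.13)]
-/

noncomputable section

-- the sub-problem namespace `NavierStokesRegularity.NavierStokesRegularity` is the tree's layout (D-0017)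
set_option linter.dupNamespace false

namespace Summit.NavierStokesRegularity.NavierStokesRegularity.Theorems

open Set Finset MeasureTheory intervalIntegral
open scoped Topology
open Literature.Analysis.FluidPDE.TaoCascade

section StarvedNetworkFlux

variable {α : Fin 4 → Fin 4 → Fin 4 → ℤ × ℤ × ℤ → ℝ} {P : Fin 4 → Fin 4 → ℝ} {Q : Finset (Fin 4)}
  (hs : IsSymmetricCoeff α) (hc : IsCancellingCoeff α)
  (hO : ∀ (Y : Fin 4 → ℤ → ℝ → ℝ) (τ : ℝ), (∀ (j : Fin 4) (k : ℤ), 1 ≤ k → 0 ≤ Y j k τ) →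
    ∀ δ : ℝ, 0 < δ → ∀ (i : Fin 4) (n : ℤ), 1 ≤ n → Y i n τ = 0 → 0 ≤ quadTerm δ α Y i n τ)
  (hD : ∀ a b i : Fin 4, a ≠ b → α a b i (0, 0, 1) = 0)
  (hPump : ∀ a d : Fin 4, α a a d (0, 0, 0) = P a d)
  (hCz : ∀ a b d : Fin 4, a ≠ b → a ≠ d → b ≠ d → α a b d (0, 0, 0) = 0)
  (hQw : ∀ d ∈ Q, ∀ e : Fin 4, α d d e (0, 0, 1) = 0)
  (hQP : ∀ d ∈ Q, ∀ j : Fin 4, P d j = 0)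
  (hPQ : ∀ a j : Fin 4, j ∉ Q → P a j = 0)
include hs hc hO hD hPump hCz hQw hQP hPQ

omit hs hc hO hD hPump hCz hQw hQP hPQ in
/-- **The live out-flux of gate `n` is the live in-flux of shell `n+1`** (the same double sum after renaming). [this file] -/
theorem starved_liveOut_eq_liveIn_succ (ε₀ : ℝ) (X : Fin 4 → ℤ → ℝ → ℝ) (n : ℤ) (t : ℝ) :
    (1 + ε₀) ^ ((5 : ℝ) * n / 2) * ∑ i, ∑ j ∈ Qᶜ, α i i j (0, 0, 1) * X i n t ^ 2 * X j (n + 1) t =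
      (1 + ε₀) ^ ((5 : ℝ) * (((n + 1 : ℤ) : ℝ) - 1) / 2) *
        ∑ j ∈ Qᶜ, ∑ i, α i i j (0, 0, 1) * X i ((n + 1) - 1) t ^ 2 * X j (n + 1) t := by
  rw [Finset.sum_comm]
  push_cast
  simp only [add_sub_cancel_right]

omit hQw in
/-- **Live-block identity**: `Σ_{e∉Q} x_{e,n}·quadTerm_e(n) = LIN_n − OUT_n − PUMP_n` (the pockets emit nothing, so the gate flux
and the pump work are full sums). MODEL lattice algebra. [cite: Tao2016AveragedNS, §4 (4.8)] -/
theorem starved_liveBlock_identity (ε₀ : ℝ) (X : Fin 4 → ℤ → ℝ → ℝ) (n : ℤ) (t : ℝ)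
    (hQw : ∀ d ∈ Q, ∀ e : Fin 4, α d d e (0, 0, 1) = 0) :
    ∑ e ∈ Qᶜ, X e n t * quadTerm ε₀ α X e n t =
      (1 + ε₀) ^ ((5 : ℝ) * ((n : ℝ) - 1) / 2) * ∑ e ∈ Qᶜ, ∑ a, α a a e (0, 0, 1) * X a (n - 1) t ^ 2 * X e n t -
        (1 + ε₀) ^ ((5 : ℝ) * n / 2) * ∑ i, ∑ j, α i i j (0, 0, 1) * X i n t ^ 2 * X j (n + 1) t -
        (1 + ε₀) ^ ((5 : ℝ) * n / 2) * ∑ i, X i n t ^ 2 * ∑ d, P i d * X d n t := by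
  set Λm : ℝ := (1 + ε₀) ^ ((5 : ℝ) * ((n : ℝ) - 1) / 2) with hΛm
  set Λn : ℝ := (1 + ε₀) ^ ((5 : ℝ) * n / 2) with hΛn
  have hterm : ∀ e ∈ Qᶜ, X e n t * quadTerm ε₀ α X e n t =
      Λm * ∑ a, α a a e (0, 0, 1) * X a (n - 1) t ^ 2 * X e n t -
        Λn * ∑ j, α e e j (0, 0, 1) * X e n t ^ 2 * X j (n + 1) t -
        Λn * (X e n t ^ 2 * ∑ d, P e d * X d n t) := by
    intro e he
    rw [Finset.mem_compl] at he
    rw [starved_quadTerm_live hs hc hO hD hPump hCz hPQ ε₀ X he]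
    have eA : X e n t * (Λm * ∑ a, α a a e (0, 0, 1) * X a (n - 1) t ^ 2) =
        Λm * ∑ a, α a a e (0, 0, 1) * X a (n - 1) t ^ 2 * X e n t := by
      simp only [Finset.mul_sum]
      exact Finset.sum_congr rfl fun a _ => by ring
    have eB : X e n t * (Λn * (X e n t * ∑ j, α e e j (0, 0, 1) * X j (n + 1) t)) =
        Λn * ∑ j, α e e j (0, 0, 1) * X e n t ^ 2 * X j (n + 1) t := by
      simp only [Finset.mul_sum]
      exact Finset.sum_congr rfl fun j _ => by ring
    have eC : X e n t * (Λn * (X e n t * ∑ d, P e d * X d n t)) = Λn * (X e n t ^ 2 * ∑ d, P e d * X d n t) := by ring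
    rw [mul_sub, mul_sub, eA, eB, eC]
  rw [Finset.sum_congr rfl hterm, Finset.sum_sub_distrib, Finset.sum_sub_distrib, ← Finset.mul_sum, ← Finset.mul_sum,
    ← Finset.mul_sum]
  -- the pockets emit nothing: extend the live sums of the drains to full sums
  have hout : ∑ e ∈ Qᶜ, ∑ j, α e e j (0, 0, 1) * X e n t ^ 2 * X j (n + 1) t =
      ∑ i, ∑ j, α i i j (0, 0, 1) * X i n t ^ 2 * X j (n + 1) t := by
    refine Finset.sum_subset (Finset.subset_univ _) fun d _ hd => ?_
    have hdQ : d ∈ Q := by simpa [Finset.mem_compl] using hd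
    exact Finset.sum_eq_zero fun j _ => by rw [hQw d hdQ j]; ring
  have hpump : ∑ e ∈ Qᶜ, X e n t ^ 2 * ∑ d, P e d * X d n t = ∑ i, X i n t ^ 2 * ∑ d, P i d * X d n t := by
    refine Finset.sum_subset (Finset.subset_univ _) fun d _ hd => ?_
    have hdQ : d ∈ Q := by simpa [Finset.mem_compl] using hd
    have : ∑ j, P d j * X j n t = 0 := Finset.sum_eq_zero fun j _ => by rw [hQP d hdQ j]; ring
    rw [this, mul_zero]
  rw [hout, hpump]

/-- **LIVE-BLOCK BALANCE of a shell `n ≥ 1`**: `∫₀ᵗ OUT_n + ∫₀ᵗ PUMP_n ≤ ∫₀ᵗ LIN_n` along an honest non-negative `ν`-viscous solution from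
a one-shell datum (`ν ≥ 0`, `ε₀ ≥ 0`): the live energy `Σ_{e∉Q} ½x²_{e,n}` starts at `0`, is `≥ 0`, and its derivative is
`LIN_n − OUT_n − PUMP_n − 2ν(1+ε₀)^{2n}·(live energy)`. MODEL lattice statement. [cite: Tao2016AveragedNS, §4 (4.8)–(4.9), (4.13)] -/
theorem starved_live_balance {ε₀ ν s : ℝ} (hε : 0 ≤ ε₀) (hν : 0 ≤ ν)
    {X₀ : Fin 4 → ℝ} {X : Fin 4 → ℤ → ℝ → ℝ}
    (hdat : ∀ (i : Fin 4) (k : ℤ), X i k 0 = if k = 0 then X₀ i else 0)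
    (hXc : ∀ (i : Fin 4) (k : ℤ), Continuous (X i k))
    (hode : ∀ (i : Fin 4) (k : ℤ), ∀ t ∈ Icc (0 : ℝ) s, HasDerivWithinAt (X i k)
      (quadTerm ε₀ α X i k t - ν * (1 + ε₀) ^ ((2 : ℝ) * k) * X i k t) (Icc (0 : ℝ) s) t)
    {n : ℤ} (hn : 1 ≤ n) :
    ∀ t ∈ Icc (0 : ℝ) s,
      (∫ τ in (0 : ℝ)..t, (1 + ε₀) ^ ((5 : ℝ) * n / 2) * ∑ i, ∑ j, α i i j (0, 0, 1) * X i n τ ^ 2 * X j (n + 1) τ) +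
        (∫ τ in (0 : ℝ)..t, (1 + ε₀) ^ ((5 : ℝ) * n / 2) * ∑ i, X i n τ ^ 2 * ∑ d, P i d * X d n τ) ≤
        ∫ τ in (0 : ℝ)..t, (1 + ε₀) ^ ((5 : ℝ) * ((n : ℝ) - 1) / 2) *
          ∑ e ∈ Qᶜ, ∑ a, α a a e (0, 0, 1) * X a (n - 1) τ ^ 2 * X e n τ := by
  have hb : (0 : ℝ) < 1 + ε₀ := by linarith
  set Λn : ℝ := (1 + ε₀) ^ ((5 : ℝ) * n / 2) with hΛn
  set Λm : ℝ := (1 + ε₀) ^ ((5 : ℝ) * ((n : ℝ) - 1) / 2) with hΛm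
  set ν' : ℝ := ν * (1 + ε₀) ^ ((2 : ℝ) * n) with hν'
  have hν'0 : 0 ≤ ν' := by positivity
  set IN : ℝ → ℝ := fun τ => Λm * ∑ e ∈ Qᶜ, ∑ a, α a a e (0, 0, 1) * X a (n - 1) τ ^ 2 * X e n τ with hIN
  set OUT : ℝ → ℝ := fun τ => Λn * ∑ i, ∑ j, α i i j (0, 0, 1) * X i n τ ^ 2 * X j (n + 1) τ with hOUT
  set PUMP : ℝ → ℝ := fun τ => Λn * ∑ i, X i n τ ^ 2 * ∑ d, P i d * X d n τ with hPUMP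
  set DISS : ℝ → ℝ := fun τ => ν' * ∑ e ∈ Qᶜ, X e n τ ^ 2 with hDISS
  have hINc : Continuous IN := continuous_const.mul (continuous_finsetSum _ fun e _ => continuous_finsetSum _ fun a _ =>
    (continuous_const.mul ((hXc a _).pow 2)).mul (hXc e _))
  have hOUTc : Continuous OUT := continuous_const.mul (continuous_finsetSum _ fun i _ => continuous_finsetSum _ fun j _ =>
    (continuous_const.mul ((hXc i _).pow 2)).mul (hXc j _))
  have hPUMPc : Continuous PUMP := continuous_const.mul (continuous_finsetSum _ fun i _ =>
    ((hXc i _).pow 2).mul (continuous_finsetSum _ fun d _ => continuous_const.mul (hXc d _)))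
  have hDISSc : Continuous DISS := continuous_const.mul (continuous_finsetSum _ fun e _ => (hXc e _).pow 2)
  -- the live energy of shell `n` and its balance
  set L : ℝ → ℝ := fun τ => ∑ e ∈ Qᶜ, (1 / 2 : ℝ) * X e n τ ^ 2 with hL
  set G : ℝ → ℝ := fun τ => L τ - (∫ u in (0 : ℝ)..τ, IN u) + (∫ u in (0 : ℝ)..τ, OUT u) + (∫ u in (0 : ℝ)..τ, PUMP u) +
    ∫ u in (0 : ℝ)..τ, DISS u with hG
  have hprim : ∀ {f : ℝ → ℝ}, Continuous f → ∀ τ : ℝ,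
      HasDerivWithinAt (fun u => ∫ v in (0 : ℝ)..u, f v) (f τ) (Icc 0 s) τ := by
    intro f hf τ
    exact (intervalIntegral.integral_hasDerivAt_right (hf.intervalIntegrable _ _)
      (hf.stronglyMeasurableAtFilter _ _) hf.continuousAt).hasDerivWithinAt
  have hGd : ∀ τ ∈ Icc (0 : ℝ) s, HasDerivWithinAt G 0 (Icc 0 s) τ := by
    intro τ hτ
    have hsq : ∀ e ∈ Qᶜ, HasDerivWithinAt (fun u => (1 / 2 : ℝ) * X e n u ^ 2)
        ((1 / 2 : ℝ) * (((2 : ℕ) : ℝ) * X e n τ ^ (2 - 1) *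
          (quadTerm ε₀ α X e n τ - ν * (1 + ε₀) ^ ((2 : ℝ) * n) * X e n τ))) (Icc 0 s) τ :=
      fun e _ => ((hode e n τ hτ).pow 2).const_mul (1 / 2)
    have hLd : HasDerivWithinAt L (∑ e ∈ Qᶜ, (1 / 2 : ℝ) * (((2 : ℕ) : ℝ) * X e n τ ^ (2 - 1) *
          (quadTerm ε₀ α X e n τ - ν * (1 + ε₀) ^ ((2 : ℝ) * n) * X e n τ))) (Icc 0 s) τ :=
      HasDerivWithinAt.fun_sum hsq
    have h := ((((hLd.sub (hprim hINc τ)).add (hprim hOUTc τ)).add (hprim hPUMPc τ)).add (hprim hDISSc τ))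
    refine h.congr_deriv ?_
    have hlive := starved_liveBlock_identity hs hc hO hD hPump hCz hQP hPQ ε₀ X n τ hQw
    have hsum : ∑ e ∈ Qᶜ, (1 / 2 : ℝ) * (((2 : ℕ) : ℝ) * X e n τ ^ (2 - 1) *
          (quadTerm ε₀ α X e n τ - ν * (1 + ε₀) ^ ((2 : ℝ) * n) * X e n τ)) =
        ∑ e ∈ Qᶜ, X e n τ * quadTerm ε₀ α X e n τ - ν' * ∑ e ∈ Qᶜ, X e n τ ^ 2 := by
      rw [Finset.mul_sum, ← Finset.sum_sub_distrib]
      refine Finset.sum_congr rfl fun e _ => ?_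
      simp only [hν']
      push_cast
      ring
    rw [hsum, hlive]
    simp only [hIN, hOUT, hPUMP, hDISS, hΛm, hΛn]
    ring
  have hGc : ContinuousOn G (Icc 0 s) := fun τ hτ => (hGd τ hτ).continuousWithinAt
  have hGd' : ∀ u ∈ Ico (0 : ℝ) s, HasDerivWithinAt G 0 (Ici u) u := fun u hu =>
    (hGd u (Ico_subset_Icc_self hu)).mono_of_mem_nhdsWithin
      (Filter.mem_of_superset (Icc_mem_nhdsGE hu.2) (Icc_subset_Icc hu.1 le_rfl))
  have hG0 : G 0 = 0 := by
    have h0 : ∀ i : Fin 4, X i n 0 = 0 := fun i => by rw [hdat]; simp; omega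
    simp [hG, hL, h0]
  intro t ht
  have hGt : G t = 0 := by
    have h := constant_of_has_deriv_right_zero hGc hGd' t ht
    rw [hG0] at h
    exact h
  have hV : 0 ≤ ∫ u in (0 : ℝ)..t, DISS u :=
    intervalIntegral.integral_nonneg ht.1 fun u _ => mul_nonneg hν'0 (Finset.sum_nonneg fun e _ => sq_nonneg _)
  have hE : 0 ≤ L t := Finset.sum_nonneg fun e _ => by positivity
  simp only [hG] at hGt
  show (∫ u in (0 : ℝ)..t, OUT u) + (∫ u in (0 : ℝ)..t, PUMP u) ≤ ∫ u in (0 : ℝ)..t, IN u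
  linarith

/-- **The exits dominate the onward feeds, pointwise**: under GRAM DOMINATION (`r·Σ_{e∉Q} w_{ae}w_{ce} ≤ Σ_{d∈Q}(P a d·P c d + w_{ad}w_{cd})`
for live `a, c`; `P ≥ 0`, `r ≥ 0`), at every shell `n ≥ 1` and `t ∈ [0,s]`: `(1+r)·LOUT_n(t) ≤ OUT_n(t) + PUMP_n(t)` (termwise in the source
`i`, by `starved_domination` times `x²_{i,n} ≥ 0`). MODEL lattice statement. [cite: Teschl2012, §2.4 (Grönwall)] -/
theorem starved_exit_dominates {ε₀ ν s r : ℝ} (hε : 0 ≤ ε₀) (hν : 0 ≤ ν) (hr0 : 0 ≤ r) (hPnn : ∀ a d, 0 ≤ P a d)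
    (hGram : ∀ a c : Fin 4, a ∉ Q → c ∉ Q →
      r * ∑ e ∈ Qᶜ, α a a e (0, 0, 1) * α c c e (0, 0, 1) ≤
        ∑ d ∈ Q, (P a d * P c d + α a a d (0, 0, 1) * α c c d (0, 0, 1)))
    {X₀ : Fin 4 → ℝ} {X : Fin 4 → ℤ → ℝ → ℝ}
    (hdat : ∀ (i : Fin 4) (k : ℤ), X i k 0 = if k = 0 then X₀ i else 0)
    (hode : ∀ (i : Fin 4) (k : ℤ), ∀ t ∈ Icc (0 : ℝ) s, HasDerivWithinAt (X i k)
      (quadTerm ε₀ α X i k t - ν * (1 + ε₀) ^ ((2 : ℝ) * k) * X i k t) (Icc (0 : ℝ) s) t)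
    (hnn : ∀ t ∈ Icc (0 : ℝ) s, ∀ (i : Fin 4) (k : ℤ), 1 ≤ k → 0 ≤ X i k t)
    {n : ℤ} (hn : 1 ≤ n) :
    ∀ t ∈ Icc (0 : ℝ) s,
      (1 + r) * ((1 + ε₀) ^ ((5 : ℝ) * n / 2) * ∑ i, ∑ j ∈ Qᶜ, α i i j (0, 0, 1) * X i n t ^ 2 * X j (n + 1) t) ≤
        (1 + ε₀) ^ ((5 : ℝ) * n / 2) * ∑ i, ∑ j, α i i j (0, 0, 1) * X i n t ^ 2 * X j (n + 1) t +
        (1 + ε₀) ^ ((5 : ℝ) * n / 2) * ∑ i, X i n t ^ 2 * ∑ d, P i d * X d n t := by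
  intro t ht
  have hΛ : 0 ≤ (1 + ε₀) ^ ((5 : ℝ) * n / 2) := Real.rpow_nonneg (by linarith) _
  have hw0 : ∀ c i : Fin 4, 0 ≤ α c c i (0, 0, 1) := fun c i => kpProper_feed_nonneg hO c i
  -- split the gate flux by live / pocket targets
  have hsplit : ∀ i : Fin 4, ∑ j, α i i j (0, 0, 1) * X i n t ^ 2 * X j (n + 1) t =
      (∑ j ∈ Q, α i i j (0, 0, 1) * X i n t ^ 2 * X j (n + 1) t) +
        ∑ j ∈ Qᶜ, α i i j (0, 0, 1) * X i n t ^ 2 * X j (n + 1) t :=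
    fun i => (Finset.sum_add_sum_compl Q _).symm
  -- termwise domination in the source `i`
  have hterm : ∀ i : Fin 4, r * ∑ j ∈ Qᶜ, α i i j (0, 0, 1) * X i n t ^ 2 * X j (n + 1) t ≤
      (∑ j ∈ Q, α i i j (0, 0, 1) * X i n t ^ 2 * X j (n + 1) t) + X i n t ^ 2 * ∑ d, P i d * X d n t := by
    intro i
    by_cases hiQ : i ∈ Q
    · have h1 : ∑ j ∈ Qᶜ, α i i j (0, 0, 1) * X i n t ^ 2 * X j (n + 1) t = 0 :=
        Finset.sum_eq_zero fun j _ => by rw [hQw i hiQ j]; ring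
      have h2 : ∑ j ∈ Q, α i i j (0, 0, 1) * X i n t ^ 2 * X j (n + 1) t = 0 :=
        Finset.sum_eq_zero fun j _ => by rw [hQw i hiQ j]; ring
      have h3 : ∑ d, P i d * X d n t = 0 := Finset.sum_eq_zero fun d _ => by rw [hQP i hiQ d]; ring
      rw [h1, h2, h3]
      simp
    · have hdom := starved_domination hs hc hO hD hPump hCz hQw hQP hPQ hε hν hr0 hPnn hGram hdat hode hnn hiQ hn t ht
      have hx2 : 0 ≤ X i n t ^ 2 := sq_nonneg _
      have hpumpQ : ∑ d, P i d * X d n t = ∑ d ∈ Q, P i d * X d n t := by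
        symm
        refine Finset.sum_subset (Finset.subset_univ _) fun d _ hd => ?_
        rw [hPQ i d hd, zero_mul]
      have e1 : r * ∑ j ∈ Qᶜ, α i i j (0, 0, 1) * X i n t ^ 2 * X j (n + 1) t =
          X i n t ^ 2 * (r * ∑ e ∈ Qᶜ, α i i e (0, 0, 1) * X e (n + 1) t) := by
        rw [Finset.mul_sum, Finset.mul_sum, Finset.mul_sum]
        exact Finset.sum_congr rfl fun j _ => by ring
      have e2 : (∑ j ∈ Q, α i i j (0, 0, 1) * X i n t ^ 2 * X j (n + 1) t) + X i n t ^ 2 * ∑ d, P i d * X d n t =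
          X i n t ^ 2 * ∑ d ∈ Q, (P i d * X d n t + α i i d (0, 0, 1) * X d (n + 1) t) := by
        rw [hpumpQ, Finset.mul_sum, Finset.mul_sum, ← Finset.sum_add_distrib]
        exact Finset.sum_congr rfl fun d _ => by ring
      rw [e1, e2]
      exact mul_le_mul_of_nonneg_left hdom hx2
  have hsum : r * ∑ i, ∑ j ∈ Qᶜ, α i i j (0, 0, 1) * X i n t ^ 2 * X j (n + 1) t ≤
      (∑ i, ∑ j ∈ Q, α i i j (0, 0, 1) * X i n t ^ 2 * X j (n + 1) t) + ∑ i, X i n t ^ 2 * ∑ d, P i d * X d n t := by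
    rw [Finset.mul_sum, ← Finset.sum_add_distrib]
    exact Finset.sum_le_sum fun i _ => hterm i
  have hfull : ∑ i, ∑ j, α i i j (0, 0, 1) * X i n t ^ 2 * X j (n + 1) t =
      (∑ i, ∑ j ∈ Q, α i i j (0, 0, 1) * X i n t ^ 2 * X j (n + 1) t) +
        ∑ i, ∑ j ∈ Qᶜ, α i i j (0, 0, 1) * X i n t ^ 2 * X j (n + 1) t := by
    rw [← Finset.sum_add_distrib]
    exact Finset.sum_congr rfl fun i _ => hsplit i
  rw [hfull, ← mul_add]
  rw [show (1 + r) * ((1 + ε₀) ^ ((5 : ℝ) * n / 2) * ∑ i, ∑ j ∈ Qᶜ, α i i j (0, 0, 1) * X i n t ^ 2 * X j (n + 1) t) =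
      (1 + ε₀) ^ ((5 : ℝ) * n / 2) * ((1 + r) * ∑ i, ∑ j ∈ Qᶜ, α i i j (0, 0, 1) * X i n t ^ 2 * X j (n + 1) t) by ring]
  refine mul_le_mul_of_nonneg_left ?_ hΛ
  linarith

/-- **STARVATION OF THE LIVE FLUXES, one step** (`n ≥ 1`): `(1+r)·∫₀ᵗ LOUT_n ≤ ∫₀ᵗ LIN_n` (live balance + exit domination).
MODEL lattice statement. [cite: Tao2016AveragedNS, §4 (4.8)–(4.9), (4.13)] -/
theorem starved_flux_step {ε₀ ν s r : ℝ} (hε : 0 ≤ ε₀) (hν : 0 ≤ ν) (hr0 : 0 ≤ r) (hPnn : ∀ a d, 0 ≤ P a d)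
    (hGram : ∀ a c : Fin 4, a ∉ Q → c ∉ Q →
      r * ∑ e ∈ Qᶜ, α a a e (0, 0, 1) * α c c e (0, 0, 1) ≤
        ∑ d ∈ Q, (P a d * P c d + α a a d (0, 0, 1) * α c c d (0, 0, 1)))
    {X₀ : Fin 4 → ℝ} {X : Fin 4 → ℤ → ℝ → ℝ}
    (hdat : ∀ (i : Fin 4) (k : ℤ), X i k 0 = if k = 0 then X₀ i else 0)
    (hXc : ∀ (i : Fin 4) (k : ℤ), Continuous (X i k))
    (hode : ∀ (i : Fin 4) (k : ℤ), ∀ t ∈ Icc (0 : ℝ) s, HasDerivWithinAt (X i k)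
      (quadTerm ε₀ α X i k t - ν * (1 + ε₀) ^ ((2 : ℝ) * k) * X i k t) (Icc (0 : ℝ) s) t)
    (hnn : ∀ t ∈ Icc (0 : ℝ) s, ∀ (i : Fin 4) (k : ℤ), 1 ≤ k → 0 ≤ X i k t)
    {n : ℤ} (hn : 1 ≤ n) :
    ∀ t ∈ Icc (0 : ℝ) s,
      (1 + r) * ∫ τ in (0 : ℝ)..t, (1 + ε₀) ^ ((5 : ℝ) * n / 2) *
          ∑ i, ∑ j ∈ Qᶜ, α i i j (0, 0, 1) * X i n τ ^ 2 * X j (n + 1) τ ≤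
        ∫ τ in (0 : ℝ)..t, (1 + ε₀) ^ ((5 : ℝ) * ((n : ℝ) - 1) / 2) *
          ∑ e ∈ Qᶜ, ∑ a, α a a e (0, 0, 1) * X a (n - 1) τ ^ 2 * X e n τ := by
  intro t ht
  have hbal := starved_live_balance hs hc hO hD hPump hCz hQw hQP hPQ hε hν hdat hXc hode hn t ht
  have hLOUTc : Continuous (fun τ => (1 + ε₀) ^ ((5 : ℝ) * n / 2) *
      ∑ i, ∑ j ∈ Qᶜ, α i i j (0, 0, 1) * X i n τ ^ 2 * X j (n + 1) τ) :=
    continuous_const.mul (continuous_finsetSum _ fun i _ => continuous_finsetSum _ fun j _ =>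
      (continuous_const.mul ((hXc i _).pow 2)).mul (hXc j _))
  have hOUTc : Continuous (fun τ => (1 + ε₀) ^ ((5 : ℝ) * n / 2) *
      ∑ i, ∑ j, α i i j (0, 0, 1) * X i n τ ^ 2 * X j (n + 1) τ) :=
    continuous_const.mul (continuous_finsetSum _ fun i _ => continuous_finsetSum _ fun j _ =>
      (continuous_const.mul ((hXc i _).pow 2)).mul (hXc j _))
  have hPUMPc : Continuous (fun τ => (1 + ε₀) ^ ((5 : ℝ) * n / 2) * ∑ i, X i n τ ^ 2 * ∑ d, P i d * X d n τ) :=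
    continuous_const.mul (continuous_finsetSum _ fun i _ =>
      ((hXc i _).pow 2).mul (continuous_finsetSum _ fun d _ => continuous_const.mul (hXc d _)))
  have hdom : (1 + r) * (∫ τ in (0 : ℝ)..t, (1 + ε₀) ^ ((5 : ℝ) * n / 2) *
        ∑ i, ∑ j ∈ Qᶜ, α i i j (0, 0, 1) * X i n τ ^ 2 * X j (n + 1) τ) ≤
      (∫ τ in (0 : ℝ)..t, (1 + ε₀) ^ ((5 : ℝ) * n / 2) * ∑ i, ∑ j, α i i j (0, 0, 1) * X i n τ ^ 2 * X j (n + 1) τ) +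
        ∫ τ in (0 : ℝ)..t, (1 + ε₀) ^ ((5 : ℝ) * n / 2) * ∑ i, X i n τ ^ 2 * ∑ d, P i d * X d n τ := by
    rw [← intervalIntegral.integral_const_mul,
      ← intervalIntegral.integral_add (hOUTc.intervalIntegrable _ _) (hPUMPc.intervalIntegrable _ _)]
    refine intervalIntegral.integral_mono_on ht.1 ((hLOUTc.const_mul _).intervalIntegrable _ _)
      ((hOUTc.add hPUMPc).intervalIntegrable _ _) fun u hu => ?_
    have hus : u ∈ Icc (0 : ℝ) s := ⟨hu.1, hu.2.trans ht.2⟩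
    exact starved_exit_dominates hs hc hO hD hPump hCz hQw hQP hPQ hε hν hr0 hPnn hGram hdat hode hnn hn u hus
  linarith

/-- **STARVATION OF THE LIVE FLUXES**: `∫₀ᵗ LOUT_m ≤ E₀·q^m`, `q = (1+r)⁻¹`, for every `m : ℕ` and `t ∈ [0,s]` (induction; base: the live
part of the gate flux of shell `0` is at most the whole of it, which is `≤ E₀` by the class-wide flux budget `kpProper_bondFlux_budget`;
step: `starved_flux_step` with `LIN_{m+1} = LOUT_m`). MODEL lattice statement. [cite: Tao2016AveragedNS, §4 (4.8)–(4.9), (4.13)] -/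
theorem starved_liveFlux_le {ε₀ ν s r : ℝ} (hε : 0 ≤ ε₀) (hν : 0 ≤ ν) (hr0 : 0 ≤ r) (hPnn : ∀ a d, 0 ≤ P a d)
    (hGram : ∀ a c : Fin 4, a ∉ Q → c ∉ Q →
      r * ∑ e ∈ Qᶜ, α a a e (0, 0, 1) * α c c e (0, 0, 1) ≤
        ∑ d ∈ Q, (P a d * P c d + α a a d (0, 0, 1) * α c c d (0, 0, 1)))
    {X₀ : Fin 4 → ℝ} {X : Fin 4 → ℤ → ℝ → ℝ}
    (hdat : ∀ (i : Fin 4) (k : ℤ), X i k 0 = if k = 0 then X₀ i else 0)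
    (hvan : ∀ (i : Fin 4) (k : ℤ), k < 0 → ∀ t : ℝ, X i k t = 0)
    (hXc : ∀ (i : Fin 4) (k : ℤ), Continuous (X i k))
    (hode : ∀ (i : Fin 4) (k : ℤ), ∀ t ∈ Icc (0 : ℝ) s, HasDerivWithinAt (X i k)
      (quadTerm ε₀ α X i k t - ν * (1 + ε₀) ^ ((2 : ℝ) * k) * X i k t) (Icc (0 : ℝ) s) t)
    (hnn : ∀ t ∈ Icc (0 : ℝ) s, ∀ (i : Fin 4) (k : ℤ), 1 ≤ k → 0 ≤ X i k t) :
    ∀ m : ℕ, ∀ t ∈ Icc (0 : ℝ) s,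
      ∫ τ in (0 : ℝ)..t, (1 + ε₀) ^ ((5 : ℝ) * (m : ℝ) / 2) *
          ∑ i, ∑ j ∈ Qᶜ, α i i j (0, 0, 1) * X i (m : ℤ) τ ^ 2 * X j ((m : ℤ) + 1) τ ≤
        (∑ i, (1 / 2 : ℝ) * X₀ i ^ 2) * ((1 + r)⁻¹) ^ m := by
  have hr : 0 < 1 + r := by positivity
  have hb : (0 : ℝ) < 1 + ε₀ := by linarith
  have hw0 : ∀ c i : Fin 4, 0 ≤ α c c i (0, 0, 1) := fun c i => kpProper_feed_nonneg hO c i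
  intro m
  induction m with
  | zero =>
    intro t ht
    have h := kpProper_bondFlux_budget hs hc hO hD hb hν hdat hvan hXc hode 0 t ht
    have hcont : ∀ (S : Finset (Fin 4)), Continuous (fun τ => (1 + ε₀) ^ ((5 : ℝ) * ((0 : ℕ) : ℝ) / 2) *
        ∑ i, ∑ j ∈ S, α i i j (0, 0, 1) * X i ((0 : ℕ) : ℤ) τ ^ 2 * X j (((0 : ℕ) : ℤ) + 1) τ) := fun S =>
      continuous_const.mul (continuous_finsetSum _ fun i _ => continuous_finsetSum _ fun j _ =>
        (continuous_const.mul ((hXc i _).pow 2)).mul (hXc j _))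
    have hle : ∫ τ in (0 : ℝ)..t, (1 + ε₀) ^ ((5 : ℝ) * ((0 : ℕ) : ℝ) / 2) *
          ∑ i, ∑ j ∈ Qᶜ, α i i j (0, 0, 1) * X i ((0 : ℕ) : ℤ) τ ^ 2 * X j (((0 : ℕ) : ℤ) + 1) τ ≤
        ∫ τ in (0 : ℝ)..t, (1 + ε₀) ^ ((5 : ℝ) * ((0 : ℕ) : ℝ) / 2) *
          ∑ i, ∑ j, α i i j (0, 0, 1) * X i ((0 : ℕ) : ℤ) τ ^ 2 * X j (((0 : ℕ) : ℤ) + 1) τ := by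
      refine intervalIntegral.integral_mono_on ht.1 ((hcont Qᶜ).intervalIntegrable _ _)
        ((hcont Finset.univ).intervalIntegrable _ _) fun u hu => ?_
      have hus : u ∈ Icc (0 : ℝ) s := ⟨hu.1, hu.2.trans ht.2⟩
      refine mul_le_mul_of_nonneg_left (Finset.sum_le_sum fun i _ => ?_) (Real.rpow_nonneg hb.le _)
      exact Finset.sum_le_sum_of_subset_of_nonneg (Finset.subset_univ _) fun j _ _ =>
        mul_nonneg (mul_nonneg (hw0 i j) (sq_nonneg _)) (hnn u hus j _ (by norm_num))
    simpa using hle.trans h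
  | succ m ih =>
    intro t ht
    have hstep := starved_flux_step hs hc hO hD hPump hCz hQw hQP hPQ hε hν hr0 hPnn hGram hdat hXc hode hnn
      (n := (m : ℤ) + 1) (by omega) t ht
    -- the live in-flux of shell `m+1` is the live out-flux of gate `m`
    have hin : ∫ τ in (0 : ℝ)..t, (1 + ε₀) ^ ((5 : ℝ) * ((((m : ℤ) + 1 : ℤ) : ℝ) - 1) / 2) *
          ∑ e ∈ Qᶜ, ∑ a, α a a e (0, 0, 1) * X a ((m : ℤ) + 1 - 1) τ ^ 2 * X e ((m : ℤ) + 1) τ =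
        ∫ τ in (0 : ℝ)..t, (1 + ε₀) ^ ((5 : ℝ) * (m : ℝ) / 2) *
          ∑ i, ∑ j ∈ Qᶜ, α i i j (0, 0, 1) * X i (m : ℤ) τ ^ 2 * X j ((m : ℤ) + 1) τ := by
      refine intervalIntegral.integral_congr fun τ _ => ?_
      have h := (starved_liveOut_eq_liveIn_succ (α := α) (Q := Q) ε₀ X (m : ℤ) τ).symm
      have hc' : ((5 : ℝ) * (((m : ℤ) : ℤ) : ℝ) / 2) = (5 : ℝ) * (m : ℝ) / 2 := by push_cast; ring
      simpa [hc'] using h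
    rw [hin] at hstep
    have hih := ih t ht
    have hcast1 : (((m + 1 : ℕ) : ℝ)) = (((m : ℤ) + 1 : ℤ) : ℝ) := by push_cast; ring
    have hcast2 : (((m + 1 : ℕ) : ℤ)) = (m : ℤ) + 1 := by push_cast; ring
    rw [hcast1, hcast2, pow_succ]
    have h2 : ∫ τ in (0 : ℝ)..t, (1 + ε₀) ^ ((5 : ℝ) * (((m : ℤ) + 1 : ℤ) : ℝ) / 2) *
          ∑ i, ∑ j ∈ Qᶜ, α i i j (0, 0, 1) * X i ((m : ℤ) + 1) τ ^ 2 * X j ((m : ℤ) + 1 + 1) τ ≤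
        (∫ τ in (0 : ℝ)..t, (1 + ε₀) ^ ((5 : ℝ) * (m : ℝ) / 2) *
          ∑ i, ∑ j ∈ Qᶜ, α i i j (0, 0, 1) * X i (m : ℤ) τ ^ 2 * X j ((m : ℤ) + 1) τ) * (1 + r)⁻¹ := by
      rw [le_mul_inv_iff₀ hr, mul_comm]
      exact hstep
    calc _ ≤ _ := h2
      _ ≤ (∑ i, (1 / 2 : ℝ) * X₀ i ^ 2) * ((1 + r)⁻¹) ^ m * (1 + r)⁻¹ :=
          mul_le_mul_of_nonneg_right hih (inv_nonneg.2 hr.le)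
      _ = _ := by ring

end StarvedNetworkFlux

end Summit.NavierStokesRegularity.NavierStokesRegularity.Theorems

end
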